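import Summits.ValiantsHypothesis.ValiantsHypothesis.Cruxes.DualUnipotentThreeHalves.Lines.radical_split
import Summits.ValiantsHypothesis.ValiantsHypothesis.Theorems.GrenetZeonDualUnipotentThreeHalvesWordFlagPencil
import Summits.ValiantsHypothesis.ValiantsHypothesis.Theorems.GrenetZeonDualUnipotentThreeHalvesHeavyTopCompositionBlocks
import Summits.ValiantsHypothesis.ValiantsHypothesis.Theorems.GrenetZeonDualUnipotentThreeHalvesHeavyTopHalfSpeed
import Summits.ValiantsHypothesis.ValiantsHypothesis.Theorems.GrenetZeonDualUnipotentThreeHalvesHeavyTopHalfSpeedBudget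

/-!
# LINE β «half_speed» — crux `Theses.GrenetZeon.DualUnipotentThreeHalves` (stmt-ValiantsHypothesis-24318), residue R2
# `HeavyTopLaw` (`Lines/radical_split.lean :: stub_heavyTopLaw`), via the HALF-SPEED TRADEOFF LAW

Card: `Cruxes/DualUnipotentThreeHalves/Ideas/half-speed-tradeoff.md` (val-idea-30 g0; critic of record val-idea-crit-7 g0;
director-valiant b124 WAVE-2 / R285 (3)).  Pen: val-port-4 g2 (desk RULING #319 (b) / #320 — idea-30's `Sketch.lean` bytes are
evidence #56/#57 on the item and are NOT readable from a port jail, so this skeleton is TYPED FROM THE CARD BLOCK (card l.54–66,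
signatures verbatim where the card prints them); decl names are the card's).

LENS (e) strengthen-to-induct.  Replace the format-bound R2 (`n, m`, heavy top) by a FORMAT-FREE law on ONE linear space
`U ⊆ M_d(ℂ)` of nilpotent matrices: for every height `1 ≤ Θ ≤ d` there is `T ≤ U` with `Θ · codim_U T ≤ C · d²` such that every
NON-ZERO word in a letter `P ∈ U` and a letter `Q ∈ T` has `#Q ≤ Θ + #P` (`HalfSpeed Θ U T` — the line's word-tame profile
`(r, c, Θ) = (1, 1, Θ)`, cf. `RadicalSplit.WordTame`).  The profile is ADDITIVE UNDER BLOCK-TRIANGULAR GLUING (`stub_halfSpeed_glue`: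
heights add `+1` per seam, codimensions add, the corner block is free), so induction over a composition chain of `U`-invariant
subspaces (✓ `HeavyTopCompositionBound.exists_block_conj`, p648257) reduces the law `HalfSpeedLaw` (S⁺) to its IRREDUCIBLE core
`HalfSpeedIrrLaw` (C⁺) — the format, the permanent and the heavy-top hypothesis have disappeared.

STUBS (registered targets; `sorry` ONLY there): `stub_halfSpeedLaw_of_irr` (K1, L — the induction: composition chain + kill/certify
allocation + glue), `stub_halfSpeedIrrLaw` (THE LAW C⁺ on irreducible nilpotent spaces — research); K0 `stub_flagCostWordLaw_of_halfSpeedLaw`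
(M — the budget arithmetic `C₀ = 16·C + 16` and `K := N_lin⁻¹ T`) is CLOSED BY NAME since rev 3 (✓ p661921).  PROVED here: ★ `halfSpeed_glue` (THE GLUING
LEMMA — the card's first kernel deliverable, via `gword_glue_blocks`), `halfSpeed_mono`, `halfSpeed_anti`, `halfSpeed_zero` (KILL), `wordTame_of_halfSpeed`, `heavyTopWordLaw_of_flagCostWordLaw`, and the HEADS `heavyTopWordLaw_of`,
`heavyTopLaw_of` (✓ `RadicalSplit.heavyTopLaw_iff_word`), ★ `dualUnipotentThreeHalves_of : HalfSpeedIrrLaw → DualUnipotentThreeHalves`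
(BY NAME, through ✓ `RadicalSplit.dualUnipotentThreeHalves_of_law` + ✓ R1 `stub_radicalCoarsening` p623799 — the route of record of
`radical_split`, which carries that line's own `stub_gms` exactly as `krylov_seed` does), `dualUnipotentThreeHalves_of_stubs`.

BC3 PROBES (card): vs R2 — C⁺/S⁺ are STRICTLY STRONGER than R2-in-words on their class (`flagCostWordLaw_of_halfSpeedLaw` gives
S3b-in-words with NO heavy-top hypothesis); C⁺ may be FALSE where R2 is true (a fat irreducible space with an expensive half-speed
profile need not occur as `ℂN₀ + 𝒯` of a thin representation) — the separating instance is itself the line's most valuable output.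
vs the summit — only through `radical_split` (3/2 frontier rung; profile barrier p589902 consistent: nothing above `n^{3/2}`).
CALIBRATION (card): TRUE with `C = 1` on triangularisable `U`; codimension `1`, `Θ = 2` on `L′_k`, MOR's cube-zero templates,
`U(𝒩)` (checked on all words of length ≤ 9 at `k = 2`); `T = 0` on Irr₃ / Irr(4,3) (✓ p646307); the `(3,5)` corner is out of range
(`C₀ = 16C+16`).  Cheapest falsifier: a family of «2-level-only» fat irreducible spaces with `min codim · Θ / d² → ∞`.

REV 2 ((D)/(P) discipline, as α's `KrylovSeedDefs`): the objects `gword`/`HalfSpeed`/`glue`, the laws `HalfSpeedLaw`/`HalfSpeedIrrLaw`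
and the proved lemmas (★ `halfSpeed_glue`, `halfSpeed_mono/anti/zero`, `wordTame_of_halfSpeed`, `heavyTopWordLaw_of_flagCostWordLaw`,
★ `wordCheap_of_halfSpeed` = the «K given» shape of K0) now live in `Theorems/…HeavyTopHalfSpeed{Defs,}.lean` (same texts), so that
stub closers under `Theorems/` can state the stubs verbatim; this file keeps the three stubs and the heads.

REV 3 (pen val-port-1 g3, director R291 (2)/R292 (4), desk #330; δ-wire on request of val-port-2 g2 19:42:05Z): K0
`stub_flagCostWordLaw_of_halfSpeedLaw` is CLOSED BY NAME := `HalfSpeed.flagCostWordLaw_of_halfSpeedLaw` (✓ p661921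
`Theorems/…HeavyTopHalfSpeedBudget.lean`, val-port-2 g2; statement verbatim).  sorries 2 = {K1 `stub_halfSpeedLaw_of_irr`, LAW
`stub_halfSpeedIrrLaw`}; heads unchanged.

HONEST LABEL: a SKELETON.  Nothing here proves R2, 24318, S3b or 8062; the heads are compositions modulo the three stubs (and
`radical_split`'s `stub_gms`); `VP ≠ VNP` is NOT proved; no summit statement is proved by this file.
-/

noncomputable section

-- single-conjunct layout: Sub = Summit, duplicated namespace component intended
set_option linter.dupNamespace false

namespace Summit.ValiantsHypothesis.ValiantsHypothesis.Cruxes.DualUnipotentThreeHalves.HalfSpeed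

open MvPolynomial Matrix
open scoped BigOperators
open Summit.ValiantsHypothesis.ValiantsHypothesis.Cruxes.TwoDimCoefficients.DimTwoCases (AffMat IsAffine)
open Summit.ValiantsHypothesis.ValiantsHypothesis.Theorems.GrenetZeon.RadicalSplit
open Summit.ValiantsHypothesis.ValiantsHypothesis.Theses.GrenetZeon (DualUnipotentThreeHalves)
open Summit.ValiantsHypothesis.ValiantsHypothesis.Theorems.GrenetZeon.HalfSpeed

/-! ## Stubs (registered targets of the line; `sorry` ONLY here) -/

/-- STUB K1 (L; the INDUCTION) — **C⁺ ⇒ S⁺**: block-triangularise `U` along a composition chain of `U`-invariant subspaces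
(✓ `HeavyTopCompositionBound.exists_block_conj`: irreducible OR ZERO constituents of sizes `d_t`), certify the constituents with
`d_t ≥ 2d/Θ` at height `Θ_t = ⌊Θ·d_t/(2d)⌋ ≥ 1` by C⁺ (at most `Θ/2` of them; cost `Σ C·d_t²/Θ_t ≤ 2C·d²/Θ`, the allocation
`Θ_t ∝ d_t` is optimal by Cauchy–Schwarz), pack the remaining constituents greedily into `≤ 3Θ/2 + 1` consecutive groups of size
`≤ 2d/Θ` and KILL them (`halfSpeed_zero`; cost `≤ d²/Θ`), glue (✓ `halfSpeed_glue`, `≤ 2Θ + 1` parts), heights off the grid by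
`halfSpeed_mono`: constant `3·(2C + 1)`.  BC3: vs R2 — a statement about ONE matrix space, no format; vs the summit — none. -/
theorem stub_halfSpeedLaw_of_irr : HalfSpeedIrrLaw → HalfSpeedLaw := by
  sorry

/-- STUB K0 (M; the BUDGET ARITHMETIC) — **S⁺ ⇒ S3b-in-words** (`FlagCostWordLaw`, `C₀ = 16·C + 16`): apply S⁺ to the space
`U = ℂ·N(0) + N_lin(ℂ^{n×n}) ⊆ M_m(ℂ)` of an affine nilpotent pencil (✓ `isNilpotent_of_mem_span_sup_range`) at height
`Θ = n − 1 − 2s`, take `K := N_lin⁻¹(T)` (`codim K ≤ codim_U T < s·n` is solvable with `s ≤ n/4` exactly when `C₀·m² < n³`), and read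
`HalfSpeed` as `WordTame n ⌊(Θ + n − 1)/2⌋` on every line (`wordTame_of_halfSpeed`) — `(k+1)·n < dim K`.  BC3: vs R2 — STRONGER
(no heavy-top hypothesis); vs the summit — none (3/2 rung only).
**CLOSED BY NAME (rev 3): ✓ p661921 `HalfSpeed.flagCostWordLaw_of_halfSpeedLaw`** (val-port-2 g2,
`Theorems/GrenetZeonDualUnipotentThreeHalvesHeavyTopHalfSpeedBudget.lean`; statement verbatim). -/
theorem stub_flagCostWordLaw_of_halfSpeedLaw : HalfSpeedLaw → FlagCostWordLaw :=
  Summit.ValiantsHypothesis.ValiantsHypothesis.Theorems.GrenetZeon.HalfSpeed.flagCostWordLaw_of_halfSpeedLaw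

/-- STUB (THE LAW C⁺, research rung) — **the half-speed law on irreducible nilpotent spaces.**  CALIBRATION: `T = 0` certifies
Irr₃ / Irr(4,3) (✓ p646307; dimension ≤ 3); `L′_k`, MOR's cube-zero templates and `U(𝒩)` (dimension ≈ d²/6, irreducible) are
certified at `Θ = 2` with codimension `1` by the rigid-return grading; the htc cell's ι-engine outputs at `(6,12..15)/(7,20)` are
the first untested instances.  WHY IT MIGHT FAIL: a family of «2-level-only» fat irreducible spaces (fat two-way traffic
`V₁ ⇄ V₂` with nilpotent returns and no common flag) with `min codim · Θ / d² → ∞`; none is known (MOR 1991 §5: the maximal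
dimension of an irreducible nilpotent space is OPEN).  BC3: vs R2 — independent in logic (C⁺ is about spaces that need not be
pencil spaces), STRONGER on its class; vs the summit — none. -/
theorem stub_halfSpeedIrrLaw : HalfSpeedIrrLaw := by
  sorry

/-! ## Heads (kernel-checked compositions; no `sorry` below this line) -/

/-- R2-in-words from C⁺. -/
theorem heavyTopWordLaw_of (h : HalfSpeedIrrLaw) : HeavyTopWordLaw :=
  heavyTopWordLaw_of_flagCostWordLaw (stub_flagCostWordLaw_of_halfSpeedLaw (stub_halfSpeedLaw_of_irr h))

/-- **R2 from C⁺** (✓ `RadicalSplit.heavyTopLaw_iff_word`: the flag and word currencies agree on affine pencils). -/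
theorem heavyTopLaw_of (h : HalfSpeedIrrLaw) : HeavyTopLaw :=
  heavyTopLaw_iff_word.2 (heavyTopWordLaw_of h)

/-- ★ **Composition.**  C⁺ implies the crux `DualUnipotentThreeHalves` BY NAME, through the `radical_split` route of record
(✓ `dualUnipotentThreeHalves_of_law`, ✓ R1 `stub_radicalCoarsening` p623799; that route's `stub_gms` travels with it). -/
theorem dualUnipotentThreeHalves_of (h : HalfSpeedIrrLaw) : DualUnipotentThreeHalves :=
  RadicalSplit.dualUnipotentThreeHalves_of_law RadicalSplit.stub_radicalCoarsening (heavyTopLaw_of h)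

/-- The crux from the stubs. -/
theorem dualUnipotentThreeHalves_of_stubs : DualUnipotentThreeHalves :=
  dualUnipotentThreeHalves_of stub_halfSpeedIrrLaw

end Summit.ValiantsHypothesis.ValiantsHypothesis.Cruxes.DualUnipotentThreeHalves.HalfSpeed

end
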